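import Literature.Geometry.Manifold.TubeChain
import HarnessLib

/-!
# A finite chain of compatibly overlapping necks is a tube

General differential topology (topic `Geometry/Manifold`; everything PROVED, no definitions, no
named facts). The driver of the chaining of `TubeChain.lean`: necks `ψ 0, …, ψ N : F × ℝ ↪ M`
(smooth embeddings of the cylinder over a compact connected `F`, open ranges) such that, for each
`i < N`, the next neck `ψ (i+1)` has its bottom `ψ (i+1) (F × (-∞, β₁ i])` inside the top part
`ψ i (F × (t* i, ∞))` of the previous one, meets the previous one only there and only by an initial
segment `ψ (i+1) (F × (-∞, β₂ i))`, misses all earlier necks, and is monotonically compatible with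
`ψ i` on the zone `F × [β₀ i, β₁ i]` (the height of `ψ i` increases along the axial curves of
`ψ (i+1)`), with thresholds `t* (i+1) ≥ β₁ i` — carry a height function without critical points,
proper on the union, equal to the height of `ψ 0` on its bottom `ψ 0 (F × (-∞, t* 0])` and to the
height of `ψ N` plus a constant on its top part (`exists_heightFunction_of_neckChain`, by
induction on `N` with `exists_heightFunction_extend`); hence (`exists_tube_of_neckChain`, by
`exists_isSmoothEmbedding_of_heightFunction` and `image_slice_eq_inter_preimage`) the union
`⋃ᵢ ψ i (F × ℝ)` is the range of ONE smooth embedding `ι : F × ℝ ↪ M` whose slices below the level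
`t* 0` are the slices of `ψ 0` and above the level `t* N` those of `ψ N`, in order. This is
Hamilton's "we wish to combine two overlapping necks into one long one" (Comm. Anal. Geom. 5 (1997),
§C2, p. 31) iterated along a chain, and Chen–Zhu's "we can take a point on the boundary of the
second `ε`-neck and continue" (J. Differential Geom. 74 (2006), §5, arXiv p. 24), in metric-free
form: the metric enters only in verifying the overlap hypotheses for `ε`-necks.

## References

* R. S. Hamilton, *Four-manifolds with positive isotropic curvature*, Comm. Anal. Geom. 5 (1997)
  1–92, §C2, p. 31. [Hamilton1997]
* B.-L. Chen, X.-P. Zhu, *Ricci flow with surgery on four-manifolds with positive isotropic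
  curvature*, J. Differential Geom. 74 (2006), §5 (arXiv:math/0504478, p. 24). [ChenZhu2006]
* M. W. Hirsch, *Differential Topology*, GTM 33 (1976), Ch. 6 §2, Thm. 2.2. [HirschDT1976]
-/

open scoped Manifold ContDiff Topology
open Set Function Filter Topology

noncomputable section

namespace Literature.Geometry.Manifold

universe u

section Chain

variable {E : Type u} [NormedAddCommGroup E] [NormedSpace ℝ E]
  {H : Type*} [TopologicalSpace H] {I : ModelWithCorners ℝ E H}
  {M : Type*} [TopologicalSpace M] [ChartedSpace H M] [IsManifold I ∞ M] [T2Space M]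
  {EF : Type*} [NormedAddCommGroup EF] [NormedSpace ℝ EF] {HF : Type*} [TopologicalSpace HF]
  {IF : ModelWithCorners ℝ EF HF}
  {F : Type*} [TopologicalSpace F] [ChartedSpace HF F] [CompactSpace F] [Nonempty F]

omit [IsManifold I ∞ M] [T2Space M] [TopologicalSpace F] [CompactSpace F] [Nonempty F] in
/-- The union of the first `k + 1` necks is open. [folklore] -/
theorem isOpen_iUnion_range_neck {ψ : ℕ → F × ℝ → M} (hψo : ∀ i, IsOpen (range (ψ i))) (k : ℕ) :
    IsOpen (⋃ i ∈ Iic k, range (ψ i)) :=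
  isOpen_biUnion fun i _ ↦ hψo i

/-- **The height function of a chain of necks** (induction on the length with
`exists_heightFunction_extend`). Under the chain hypotheses of the module docstring there is a
function `g`, smooth, proper and without critical points on `U = ⋃_{i ≤ N} ψ i (F × ℝ)`, with
`g (ψ 0 (θ, s)) = s` for `s ≤ t* 0` and `g (ψ N (θ, s)) = s + c` for `s > t* N`.
[cite: Hamilton1997, §3.2 (C2), p. 31] [cite: ChenZhu2006, §5, p. 24] -/
theorem exists_heightFunction_of_neckChain {ψ : ℕ → F × ℝ → M}
    (hψ : ∀ i, Manifold.IsSmoothEmbedding (IF.prod 𝓘(ℝ, ℝ)) I ∞ (ψ i))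
    (hψo : ∀ i, IsOpen (range (ψ i))) {tstar β₀ β₁ β₂ : ℕ → ℝ} {N : ℕ}
    (hβ : ∀ i < N, β₀ i < β₁ i) (htstar : ∀ i < N, β₁ i ≤ tstar (i + 1))
    (hbot : ∀ i < N, ψ (i + 1) '' (univ ×ˢ Iic (β₁ i)) ⊆ ψ i '' (univ ×ˢ Ioi (tstar i)))
    (hmeet : ∀ i < N, range (ψ (i + 1)) ∩ range (ψ i) ⊆
      ψ (i + 1) '' (univ ×ˢ Iio (β₂ i)) ∩ ψ i '' (univ ×ˢ Ioi (tstar i)))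
    (hdisj : ∀ i < N, ∀ j < i, Disjoint (range (ψ (i + 1))) (range (ψ j)))
    (hmono : ∀ i < N, ∀ (θ : F), ∀ s ∈ Icc (β₀ i) (β₁ i),
      ∃ d > 0, HasDerivAt (fun s : ℝ ↦ (invFun (ψ i) (ψ (i + 1) (θ, s))).2) d s) :
    ∃ (g : M → ℝ) (c : ℝ),
      ContMDiffOn I 𝓘(ℝ, ℝ) ∞ g (⋃ i ∈ Iic N, range (ψ i)) ∧
      (∀ y ∈ ⋃ i ∈ Iic N, range (ψ i), Surjective (mfderiv I 𝓘(ℝ, ℝ) g y)) ∧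
      (∀ a b : ℝ, IsCompact ((⋃ i ∈ Iic N, range (ψ i)) ∩ g ⁻¹' Icc a b)) ∧
      (∀ p : F × ℝ, p.2 ≤ tstar 0 → g (ψ 0 p) = p.2) ∧
      (∀ p : F × ℝ, tstar N < p.2 → g (ψ N p) = p.2 + c) := by
  classical
  -- the union of the first `k + 1` necks, as an open set
  set U : ℕ → TopologicalSpace.Opens M :=
    fun k ↦ ⟨⋃ i ∈ Iic k, range (ψ i), isOpen_iUnion_range_neck hψo k⟩ with hU
  have hUmem : ∀ k (y : M), y ∈ (U k : Set M) ↔ ∃ i ≤ k, y ∈ range (ψ i) := fun k y ↦ by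
    simp [hU]
  have hUsub : ∀ k i, i ≤ k → range (ψ i) ⊆ (U k : Set M) := fun k i hi y hy ↦ (hUmem k y).2 ⟨i, hi, hy⟩
  have hUsucc : ∀ k, ((U (k + 1) : TopologicalSpace.Opens M) : Set M) = (U k : Set M) ∪ range (ψ (k + 1)) := by
    intro k
    ext y
    rw [hUmem, mem_union, hUmem]
    constructor
    · rintro ⟨i, hi, hy⟩
      rcases Nat.lt_or_ge i (k + 1) with h | h
      · exact Or.inl ⟨i, Nat.lt_succ_iff.1 h, hy⟩
      · obtain rfl : i = k + 1 := le_antisymm hi h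
        exact Or.inr hy
    · rintro (⟨i, hi, hy⟩ | hy)
      · exact ⟨i, hi.trans (Nat.le_succ k), hy⟩
      · exact ⟨k + 1, le_rfl, hy⟩
  -- induction on `k ≤ N`
  suffices key : ∀ k ≤ N, ∃ (g : M → ℝ) (c : ℝ),
      ContMDiffOn I 𝓘(ℝ, ℝ) ∞ g (U k) ∧
      (∀ y ∈ (U k : Set M), Surjective (mfderiv I 𝓘(ℝ, ℝ) g y)) ∧
      (∀ a b : ℝ, IsCompact ((U k : Set M) ∩ g ⁻¹' Icc a b)) ∧
      (∀ p : F × ℝ, p.2 ≤ tstar 0 → g (ψ 0 p) = p.2) ∧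
      (∀ p : F × ℝ, tstar k < p.2 → g (ψ k p) = p.2 + c) by
    exact key N le_rfl
  intro k
  induction k with
  | zero =>
    intro _
    refine ⟨fun y ↦ (invFun (ψ 0) y).2, 0, ?_, ?_, ?_, fun p _ ↦ height_apply_neck (hψ 0) p,
      fun p _ ↦ ?_⟩
    rotate_left 3
    · show (invFun (ψ 0) (ψ 0 p)).2 = p.2 + 0
      rw [height_apply_neck (hψ 0) p, add_zero]
    · have h0 : ((U 0 : TopologicalSpace.Opens M) : Set M) = range (ψ 0) := by
        ext y; rw [hUmem]; simp
      rw [h0]; exact contMDiffOn_height (hψ 0)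
    · intro y hy
      obtain ⟨i, hi, hy⟩ := (hUmem 0 y).1 hy
      obtain rfl : i = 0 := Nat.le_zero.1 hi
      exact surjective_mfderiv_height (hψ 0) (hψo 0) hy
    · intro a b
      have h0 : ((U 0 : TopologicalSpace.Opens M) : Set M) = range (ψ 0) := by
        ext y; rw [hUmem]; simp
      rw [h0]; exact isCompact_range_inter_height_preimage_Icc (hψ 0) a b
  | succ k ih =>
    intro hk
    have hkN : k < N := Nat.lt_of_succ_le hk
    obtain ⟨g, c, hg, hdg, hK, hbot0, htop⟩ := ih hkN.le
    -- the step
    have hTU : ψ k '' (univ ×ˢ Ioi (tstar k)) ⊆ (U k : Set M) :=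
      (image_subset_range _ _).trans (hUsub k k le_rfl)
    have hmeet' : range (ψ (k + 1)) ∩ (U k : Set M) ⊆
        ψ (k + 1) '' (univ ×ˢ Iio (β₂ k)) ∩ ψ k '' (univ ×ˢ Ioi (tstar k)) := by
      rintro y ⟨hy, hyU⟩
      obtain ⟨j, hj, hyj⟩ := (hUmem k y).1 hyU
      rcases hj.lt_or_eq with hjk | rfl
      · exact absurd hyj (Set.disjoint_left.1 (hdisj k hkN j hjk) hy)
      · exact hmeet j hkN ⟨hy, hyj⟩
    obtain ⟨g', c', hg', hdg', hK', htop', heq'⟩ :=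
      exists_heightFunction_extend (U k) hg hdg hK (hψ k) hTU htop (hψ (k + 1)) (hψo (k + 1))
        (hβ k hkN) (hbot k hkN) hmeet' (hmono k hkN)
    refine ⟨g', c', ?_, ?_, ?_, ?_, ?_⟩
    · rw [hUsucc]; exact hg'
    · rw [hUsucc]; exact hdg'
    · rw [hUsucc]; exact hK'
    · -- the bottom of `ψ 0` is untouched
      intro p hp
      have hyU : ψ 0 p ∈ (U k : Set M) := hUsub k 0 (Nat.zero_le k) (mem_range_self p)
      have hnot : ψ 0 p ∉ ψ (k + 1) '' (univ ×ˢ Ici (β₀ k)) := by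
        rintro ⟨q, -, hq⟩
        have hmem : ψ 0 p ∈ range (ψ (k + 1)) := ⟨q, hq⟩
        rcases Nat.eq_zero_or_pos k with rfl | hkpos
        · -- `k = 0`: the new neck meets `ψ 0` only above `tstar 0`
          obtain ⟨-, ⟨p', ⟨-, hp'⟩, hpp'⟩⟩ := hmeet 0 hkN ⟨hmem, mem_range_self p⟩
          have : p' = p := (hψ 0).isEmbedding.injective hpp'
          rw [this] at hp'
          exact absurd hp' (not_lt.2 hp)
        · exact Set.disjoint_left.1 (hdisj k hkN 0 hkpos) hmem (mem_range_self p)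
      rw [heq' _ hyU hnot, hbot0 p hp]
    · intro p hp
      exact htop' p (lt_of_le_of_lt (htstar k hkN) hp)

omit [IsManifold I ∞ M] [T2Space M] [CompactSpace F] [Nonempty F] in
/-- The union of a chain of necks over a connected `F` is preconnected (consecutive necks meet,
by the bottom hypothesis). [folklore] -/
theorem isPreconnected_iUnion_range_neck [PreconnectedSpace F] {ψ : ℕ → F × ℝ → M}
    (hψ : ∀ i, Manifold.IsSmoothEmbedding (IF.prod 𝓘(ℝ, ℝ)) I ∞ (ψ i)) {N : ℕ}
    (hmeetne : ∀ i < N, (range (ψ (i + 1)) ∩ range (ψ i)).Nonempty) :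
    IsPreconnected (⋃ i ∈ Iic N, range (ψ i)) := by
  induction N with
  | zero =>
    have : (⋃ i ∈ Iic 0, range (ψ i)) = range (ψ 0) := by ext y; simp
    rw [this]
    exact isPreconnected_range (hψ 0).contMDiff.continuous
  | succ k ih =>
    have hsucc : (⋃ i ∈ Iic (k + 1), range (ψ i)) = (⋃ i ∈ Iic k, range (ψ i)) ∪ range (ψ (k + 1)) := by
      ext y
      simp only [mem_iUnion, mem_Iic, exists_prop, mem_union]
      constructor
      · rintro ⟨i, hi, hy⟩
        rcases Nat.lt_or_ge i (k + 1) with h | h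
        · exact Or.inl ⟨i, Nat.lt_succ_iff.1 h, hy⟩
        · obtain rfl : i = k + 1 := le_antisymm hi h
          exact Or.inr hy
      · rintro (⟨i, hi, hy⟩ | hy)
        · exact ⟨i, hi.trans (Nat.le_succ k), hy⟩
        · exact ⟨k + 1, le_rfl, hy⟩
    rw [hsucc]
    obtain ⟨y, hy1, hy0⟩ := hmeetne k (Nat.lt_succ_self k)
    have hyU : y ∈ ⋃ i ∈ Iic k, range (ψ i) := mem_biUnion (mem_Iic.2 le_rfl) hy0
    exact (ih fun i hi ↦ hmeetne i (Nat.lt_succ_of_lt hi)).union y hyU hy1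
      (isPreconnected_range (hψ (k + 1)).contMDiff.continuous)

end Chain

/-! ### The tube of a chain of necks -/

section Tube

variable {E : Type u} [NormedAddCommGroup E] [NormedSpace ℝ E] [FiniteDimensional ℝ E]
  {H : Type*} [TopologicalSpace H] {I : ModelWithCorners ℝ E H} [I.Boundaryless]
  {M : Type*} [TopologicalSpace M] [ChartedSpace H M] [IsManifold I ∞ M] [T2Space M]
  [SecondCountableTopology M]
  {EF : Type*} [NormedAddCommGroup EF] [NormedSpace ℝ EF] {HF : Type*} [TopologicalSpace HF]
  {IF : ModelWithCorners ℝ EF HF} [IF.Boundaryless]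
  {F : Type*} [TopologicalSpace F] [ChartedSpace HF F] [IsManifold IF ∞ F] [CompactSpace F]
  [Nonempty F] [PreconnectedSpace F]

/-- **A finite chain of compatibly overlapping necks is a tube.** Under the chain hypotheses of
`exists_heightFunction_of_neckChain` (necks `ψ 0, …, ψ N` over a compact connected `F`;
boundaryless models identified by `L : E_F × ℝ ≃ E`; `M` second countable over a
finite-dimensional model), the union `⋃_{i ≤ N} ψ i (F × ℝ)` is the range of one smooth embedding
`ι : F × ℝ ↪ M` whose slices are, in order, the slices of `ψ 0` below the level `t* 0` and those of
`ψ N` above the level `t* N`: `ψ 0 (F × {s}) = ι (F × {s - e})` for `s < t* 0` and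
`ψ N (F × {s}) = ι (F × {s + c - e})` for `s > t* N`. [cite: Hamilton1997, §3.2 (C2), p. 31]
[cite: ChenZhu2006, §5, p. 24] [cite: HirschDT1976, Ch. 6 §2, Thm. 2.2] -/
theorem exists_tube_of_neckChain {ψ : ℕ → F × ℝ → M}
    (hψ : ∀ i, Manifold.IsSmoothEmbedding (IF.prod 𝓘(ℝ, ℝ)) I ∞ (ψ i))
    (hψo : ∀ i, IsOpen (range (ψ i))) {tstar β₀ β₁ β₂ : ℕ → ℝ} {N : ℕ}
    (hβ : ∀ i < N, β₀ i < β₁ i) (htstar : ∀ i < N, β₁ i ≤ tstar (i + 1))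
    (hbot : ∀ i < N, ψ (i + 1) '' (univ ×ˢ Iic (β₁ i)) ⊆ ψ i '' (univ ×ˢ Ioi (tstar i)))
    (hmeet : ∀ i < N, range (ψ (i + 1)) ∩ range (ψ i) ⊆
      ψ (i + 1) '' (univ ×ˢ Iio (β₂ i)) ∩ ψ i '' (univ ×ˢ Ioi (tstar i)))
    (hdisj : ∀ i < N, ∀ j < i, Disjoint (range (ψ (i + 1))) (range (ψ j)))
    (hmono : ∀ i < N, ∀ (θ : F), ∀ s ∈ Icc (β₀ i) (β₁ i),
      ∃ d > 0, HasDerivAt (fun s : ℝ ↦ (invFun (ψ i) (ψ (i + 1) (θ, s))).2) d s)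
    (L : (EF × ℝ) ≃L[ℝ] E) :
    ∃ (ι : F × ℝ → M) (e c : ℝ), Manifold.IsSmoothEmbedding (IF.prod 𝓘(ℝ, ℝ)) I ∞ ι ∧
      range ι = ⋃ i ∈ Iic N, range (ψ i) ∧
      (∀ s : ℝ, s < tstar 0 → ψ 0 '' (univ ×ˢ {s}) = ι '' (univ ×ˢ {s - e})) ∧
      (∀ s : ℝ, tstar N < s → ψ N '' (univ ×ˢ {s}) = ι '' (univ ×ˢ {s + c - e})) := by
  obtain ⟨g, c, hg, hdg, hK, hbot0, htop⟩ :=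
    exists_heightFunction_of_neckChain hψ hψo hβ htstar hbot hmeet hdisj hmono
  set U : TopologicalSpace.Opens M := ⟨⋃ i ∈ Iic N, range (ψ i), isOpen_iUnion_range_neck hψo N⟩
    with hU
  have hUc : IsPreconnected (U : Set M) := by
    refine isPreconnected_iUnion_range_neck hψ fun i hi ↦ ?_
    obtain ⟨θ⟩ := ‹Nonempty F›
    have h1 : ψ (i + 1) (θ, β₁ i) ∈ ψ i '' (univ ×ˢ Ioi (tstar i)) :=
      hbot i hi ⟨(θ, β₁ i), ⟨mem_univ _, mem_Iic.2 le_rfl⟩, rfl⟩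
    exact ⟨_, mem_range_self _, image_subset_range _ _ h1⟩
  have h0U : ψ 0 '' (univ ×ˢ Iio (tstar 0)) ⊆ (U : Set M) :=
    (image_subset_range _ _).trans fun y hy ↦ mem_biUnion (mem_Iic.2 (Nat.zero_le N)) hy
  have hNU : ψ N '' (univ ×ˢ Ioi (tstar N)) ⊆ (U : Set M) :=
    (image_subset_range _ _).trans fun y hy ↦ mem_biUnion (mem_Iic.2 le_rfl) hy
  obtain ⟨ι, e, hι, hrange, hgι, hslice⟩ :=
    exists_isSmoothEmbedding_of_heightFunction U hUc hg hdg hK (hψ 0) (hψo 0) (t₁ := tstar 0)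
      (c₁ := 0) h0U (fun p hp ↦ by rw [hbot0 p hp.le, add_zero]) L
  refine ⟨ι, e, c, hι, hrange, fun s hs ↦ ?_, fun s hs ↦ ?_⟩
  · rw [image_slice_eq_inter_preimage U hUc hg hdg hK (hψ 0) (hψo 0) isOpen_Iio (c := 0) h0U
      (fun p hp ↦ by rw [hbot0 p (le_of_lt hp), add_zero]) hs, hslice,
      show s - e + e = s + 0 by ring]
  · rw [image_slice_eq_inter_preimage U hUc hg hdg hK (hψ N) (hψo N) isOpen_Ioi (c := c) hNU
      (fun p hp ↦ htop p hp) hs, hslice, show s + c - e + e = s + c by ring]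

end Tube

end Literature.Geometry.Manifold

end
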